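import Summits.CriticalPhenomena.PercolationContinuityZ3.Theorems.PercNearOneGluingNoHeavyLowerTailQ44ClickReduction

/-!
# Typed Marica–Schönheim families: the slicing (tensorization) inequality

Support file for crux `stmt-CriticalPhenomena-4575` (master-family programme, quadratic four-point row `Q44`), seat `prim-bnk-1`
gen 23; memo `run/shared/lean/prim/prim-l12/FROM-prim-bnk-1-gen23-MS-RECURSION.md` §1–§3.

Gen 22 reduced `Q44` (all `n`) to the click count `ClickCount q44B1 q44Darts` (`…Q44ClickReduction`).  Gen 23 rewrites the
complements of the click unions as an **allowed-difference family**: for a *typed family* `τ : Finset γ → Finset T` (each subset of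
the ground type carries a set of types) and a relation `R : T → T → Bool`,
`ZR R τ = {X \ Y : some t ∈ τ X and s ∈ τ Y have R t s}`.
With one type and `R = ⊤` this is the difference family of Marica–Schönheim; the click-union count is the case of the 26 oriented
side types with `R s t = CLICK(rev s, t)` (memo §1).

This file proves the engine of every Marica–Schönheim / Ahlswede–Daykin induction on the ground set, transplanted to typed
families (memo §2): slicing at an element `e`, the **outer** family merges the types of `X` and `insert e X`, the **inner** family
carries the VIRTUAL PAIR TYPES `τ (insert e X) ×ˢ τ X` with the relation
`RV R (t₁,t₀) (s₁,s₀) = R t₁ s₀ ∧ (R t₀ s₀ ∨ R t₀ s₁ ∨ R t₁ s₁)`, and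

* `TypedMS.card_outer_add_card_inner_le` — `#ZR R (outer e τ) + #ZR (RV R) (inner e τ) ≤ #ZR R τ`.

For a single type this is the inequality `|D(𝒜₀ ∪ 𝒜₁)| + |D(𝒜₀ ∩ 𝒜₁)| ≤ |D(𝒜)|` behind the Marica–Schönheim theorem
[Marica–Schönheim 1969; Ahlswede–Daykin 1979, cf. Anderson, *Combinatorics of Finite Sets*, Ex. 6.16].  The recursion it generates
certifies the click count `(AC₀)` on every abstract configuration with at most four ground elements (memo §3); the closed-form
invariant that would turn the recursion into a proof for all `n` is open.  No sorries, standard axioms, Mathlib only.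
-/

namespace Summit.CriticalPhenomena.PercolationContinuityZ3.Theorems

namespace TypedMS

open Finset

variable {γ : Type} [Fintype γ] [DecidableEq γ] {T : Type} [DecidableEq T]

/-- The **allowed-difference family** of a typed family `τ` under the relation `R`:
`{X \ Y : ∃ t ∈ τ X, ∃ s ∈ τ Y, R t s}`. [this work] -/
def ZR (R : T → T → Bool) (τ : Finset γ → Finset T) : Finset (Finset γ) :=
  ((Finset.univ ×ˢ Finset.univ).filter fun p : Finset γ × Finset γ =>
      ∃ t ∈ τ p.1, ∃ s ∈ τ p.2, R t s = true).image fun p => p.1 \ p.2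

omit [DecidableEq T] in
/-- Membership in the allowed-difference family. [this work] -/
theorem mem_ZR {R : T → T → Bool} {τ : Finset γ → Finset T} {S : Finset γ} :
    S ∈ ZR R τ ↔ ∃ X Y : Finset γ, (∃ t ∈ τ X, ∃ s ∈ τ Y, R t s = true) ∧ X \ Y = S := by
  unfold ZR
  constructor
  · intro h
    rw [Finset.mem_image] at h
    obtain ⟨p, hp, rfl⟩ := h
    rw [Finset.mem_filter] at hp
    exact ⟨p.1, p.2, hp.2, rfl⟩
  · rintro ⟨X, Y, h, rfl⟩
    rw [Finset.mem_image]
    refine ⟨(X, Y), ?_, rfl⟩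
    rw [Finset.mem_filter]
    exact ⟨Finset.mem_product.2 ⟨Finset.mem_univ _, Finset.mem_univ _⟩, h⟩

omit [DecidableEq T] in
/-- A witnessed difference lies in the allowed-difference family. [this work] -/
theorem sdiff_mem_ZR {R : T → T → Bool} {τ : Finset γ → Finset T} {X Y : Finset γ} {t s : T}
    (ht : t ∈ τ X) (hs : s ∈ τ Y) (h : R t s = true) : X \ Y ∈ ZR R τ :=
  mem_ZR.2 ⟨X, Y, ⟨t, ht, s, hs, h⟩, rfl⟩

/-- The **outer** (merged) family at `e`: a set `X` not containing `e` carries the types of `X` and of `insert e X`;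
sets containing `e` carry nothing. [this work] -/
def outer (e : γ) (τ : Finset γ → Finset T) : Finset γ → Finset T :=
  fun X => if e ∈ X then ∅ else τ X ∪ τ (insert e X)

/-- The **inner** (virtual pair type) family at `e`: a set `X` not containing `e` carries the pairs
`(t₁, t₀)` with `t₁ ∈ τ (insert e X)` and `t₀ ∈ τ X`. [this work] -/
def inner (e : γ) (τ : Finset γ → Finset T) : Finset γ → Finset (T × T) :=
  fun X => if e ∈ X then ∅ else τ (insert e X) ×ˢ τ X

/-- The **virtual relation** on pair types: `R t₁ s₀ ∧ (R t₀ s₀ ∨ R t₀ s₁ ∨ R t₁ s₁)` — the first conjunct realises the difference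
WITH `e`, the bracket realises it WITHOUT `e`. [this work] -/
def RV (R : T → T → Bool) : T × T → T × T → Bool :=
  fun p q => R p.1 q.2 && (R p.2 q.2 || R p.2 q.1 || R p.1 q.1)

section slicing

variable (R : T → T → Bool) (τ : Finset γ → Finset T) (e : γ)

/-- The members of `ZR R τ` not containing `e`. [this work] -/
def Z0 : Finset (Finset γ) := (ZR R τ).filter fun S => ¬ e ∈ S

/-- The members of `ZR R τ` containing `e`, with `e` erased. [this work] -/
def Z1 : Finset (Finset γ) := ((ZR R τ).filter fun S => e ∈ S).image fun S => S.erase e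

omit [DecidableEq T] in
/-- `#Z0 + #Z1 = #ZR`: erasing `e` is injective on the members containing `e`. [this work] -/
theorem card_Z0_add_card_Z1 : #(Z0 R τ e) + #(Z1 R τ e) = #(ZR R τ) := by
  unfold Z0 Z1
  rw [Finset.card_image_of_injOn, add_comm]
  · exact Finset.card_filter_add_card_filter_not (s := ZR R τ) (fun S => e ∈ S)
  · intro S hS S' hS' h
    rw [Finset.coe_filter] at hS hS'
    have h0 : S.erase e = S'.erase e := h
    have h1 : insert e (S.erase e) = insert e (S'.erase e) := by rw [h0]
    rwa [Finset.insert_erase hS.2, Finset.insert_erase hS'.2] at h1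

variable {R τ e}

omit [DecidableEq T] in
/-- Membership in `Z0`. [this work] -/
theorem mem_Z0_iff {S : Finset γ} : S ∈ Z0 R τ e ↔ S ∈ ZR R τ ∧ e ∉ S := by
  unfold Z0; rw [Finset.mem_filter]

omit [DecidableEq T] in
/-- If `insert e S ∈ ZR R τ` and `e ∉ S` then `S ∈ Z1`. [this work] -/
theorem mem_Z1_of_insert {S : Finset γ} (h : insert e S ∈ ZR R τ) (hS : e ∉ S) : S ∈ Z1 R τ e := by
  unfold Z1
  rw [Finset.mem_image]
  refine ⟨insert e S, ?_, Finset.erase_insert hS⟩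
  rw [Finset.mem_filter]
  exact ⟨h, Finset.mem_insert_self _ _⟩

omit [Fintype γ] in
/-- `e ∉ X \ Y` when `e ∉ X`. [folklore] -/
theorem not_mem_sdiff_of_not_mem_left {X Y : Finset γ} (hX : e ∉ X) : e ∉ X \ Y := by
  rw [Finset.mem_sdiff]; exact fun hh => hX hh.1

omit [Fintype γ] in
/-- `insert e X \ insert e Y = X \ Y` when `e ∉ X`. [folklore] -/
theorem insert_sdiff_insert_eq {X Y : Finset γ} (hX : e ∉ X) : insert e X \ insert e Y = X \ Y := by
  rw [Finset.insert_sdiff_of_mem _ (Finset.mem_insert_self _ _), Finset.sdiff_insert_of_notMem hX _]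

/-- **Outer ⊆ Z0 ∪ Z1**: every allowed difference of the merged family is an allowed difference of `τ`, with or without `e`.
[this work] -/
theorem ZR_outer_subset : ZR R (outer e τ) ⊆ Z0 R τ e ∪ Z1 R τ e := by
  intro S hS
  rw [mem_ZR] at hS
  obtain ⟨X, Y, ⟨t, ht, s, hs, h⟩, rfl⟩ := hS
  unfold outer at ht hs
  by_cases hX : e ∈ X
  · rw [if_pos hX] at ht; exact absurd ht (Finset.notMem_empty _)
  by_cases hY : e ∈ Y
  · rw [if_pos hY] at hs; exact absurd hs (Finset.notMem_empty _)
  rw [if_neg hX, Finset.mem_union] at ht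
  rw [if_neg hY, Finset.mem_union] at hs
  rw [Finset.mem_union]
  rcases ht with ht | ht
  · rcases hs with hs | hs
    · exact Or.inl (mem_Z0_iff.2 ⟨sdiff_mem_ZR ht hs h, not_mem_sdiff_of_not_mem_left hX⟩)
    · left
      have h1 := sdiff_mem_ZR (R := R) (τ := τ) ht hs h
      rw [Finset.sdiff_insert_of_notMem hX _] at h1
      exact mem_Z0_iff.2 ⟨h1, not_mem_sdiff_of_not_mem_left hX⟩
  · rcases hs with hs | hs
    · right
      have h1 := sdiff_mem_ZR (R := R) (τ := τ) ht hs h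
      rw [Finset.insert_sdiff_of_notMem _ hY] at h1
      exact mem_Z1_of_insert h1 (not_mem_sdiff_of_not_mem_left hX)
    · left
      have h1 := sdiff_mem_ZR (R := R) (τ := τ) ht hs h
      rw [insert_sdiff_insert_eq hX] at h1
      exact mem_Z0_iff.2 ⟨h1, not_mem_sdiff_of_not_mem_left hX⟩

omit [DecidableEq T] in
/-- **Inner ⊆ Z0 ∩ Z1**: a virtual pair realises the difference once with `e` and once without. [this work] -/
theorem ZR_inner_subset : ZR (RV R) (inner e τ) ⊆ Z0 R τ e ∩ Z1 R τ e := by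
  intro S hS
  rw [mem_ZR] at hS
  obtain ⟨X, Y, ⟨p, hp, q, hq, h⟩, rfl⟩ := hS
  unfold inner at hp hq
  by_cases hX : e ∈ X
  · rw [if_pos hX] at hp; exact absurd hp (Finset.notMem_empty _)
  by_cases hY : e ∈ Y
  · rw [if_pos hY] at hq; exact absurd hq (Finset.notMem_empty _)
  rw [if_neg hX, Finset.mem_product] at hp
  rw [if_neg hY, Finset.mem_product] at hq
  unfold RV at h
  rw [Bool.and_eq_true, Bool.or_eq_true, Bool.or_eq_true] at h
  obtain ⟨h10, hrest⟩ := h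
  rw [Finset.mem_inter]
  refine ⟨?_, ?_⟩
  · -- without e: one of the three bracket cases
    rcases hrest with (h00 | h01) | h11
    · exact mem_Z0_iff.2 ⟨sdiff_mem_ZR hp.2 hq.2 h00, not_mem_sdiff_of_not_mem_left hX⟩
    · have h1 := sdiff_mem_ZR (R := R) (τ := τ) hp.2 hq.1 h01
      rw [Finset.sdiff_insert_of_notMem hX _] at h1
      exact mem_Z0_iff.2 ⟨h1, not_mem_sdiff_of_not_mem_left hX⟩
    · have h1 := sdiff_mem_ZR (R := R) (τ := τ) hp.1 hq.1 h11
      rw [insert_sdiff_insert_eq hX] at h1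
      exact mem_Z0_iff.2 ⟨h1, not_mem_sdiff_of_not_mem_left hX⟩
  · -- with e: (t₁, s₀)
    have h1 := sdiff_mem_ZR (R := R) (τ := τ) hp.1 hq.2 h10
    rw [Finset.insert_sdiff_of_notMem _ hY] at h1
    exact mem_Z1_of_insert h1 (not_mem_sdiff_of_not_mem_left hX)

variable (R τ e)

/-- **The slicing (tensorization) inequality for typed Marica–Schönheim families**:
`#ZR R (outer e τ) + #ZR (RV R) (inner e τ) ≤ #ZR R τ`. [this work] -/
theorem card_outer_add_card_inner_le :
    #(ZR R (outer e τ)) + #(ZR (RV R) (inner e τ)) ≤ #(ZR R τ) := by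
  calc #(ZR R (outer e τ)) + #(ZR (RV R) (inner e τ))
      ≤ #(Z0 R τ e ∪ Z1 R τ e) + #(Z0 R τ e ∩ Z1 R τ e) :=
        Nat.add_le_add (Finset.card_le_card ZR_outer_subset) (Finset.card_le_card ZR_inner_subset)
    _ = #(Z0 R τ e) + #(Z1 R τ e) := Finset.card_union_add_card_inter _ _
    _ = #(ZR R τ) := card_Z0_add_card_Z1 R τ e

end slicing


/-! ## The click unions of `…Q44ClickReduction` are the complements of an allowed-difference family -/

section click

open TwoCopyMono

/-- The typed family of a cell map: the set `X` carries the single oriented type `(ι X, ι Xᶜ)`. [this work] -/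
def sideTypes (ι : Finset γ → Fin 15) : Finset γ → Finset (Fin 15 × Fin 15) := fun X => {(ι X, ι Xᶜ)}

/-- The click relation read as an allowed-difference relation on oriented types: `R s t = CLICK(rev s, t)`, i.e.
`upAC s.2 t.1 ∧ downBot s.1 t.2` (memo §1). [this work] -/
def clickRel : Fin 15 × Fin 15 → Fin 15 × Fin 15 → Bool := fun s t => upAC s.2 t.1 && downBot s.1 t.2

omit [DecidableEq γ] in
/-- `(X \ Y)ᶜ = Xᶜ ∪ Y`. [folklore] -/
theorem compl_sdiff_eq (X Y : Finset γ) [DecidableEq γ] : (X \ Y)ᶜ = Xᶜ ∪ Y := by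
  ext x
  simp only [Finset.mem_compl, Finset.mem_sdiff, Finset.mem_union, not_and, not_not]
  tauto

/-- **The click unions are the complements of the allowed differences** of the typed family `sideTypes ι` under `clickRel`.
[this work] -/
theorem image_compl_ZR_eq_clickUnions (ι : Finset γ → Fin 15) :
    (ZR clickRel (sideTypes ι)).image compl = clickUnions ι := by
  ext U
  rw [Finset.mem_image]
  unfold clickUnions
  rw [Finset.mem_image]
  constructor
  · rintro ⟨S, hS, rfl⟩
    rw [mem_ZR] at hS
    obtain ⟨X, Y, ⟨t, ht, s, hs, h⟩, rfl⟩ := hS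
    unfold sideTypes at ht hs
    rw [Finset.mem_singleton] at ht hs
    subst ht; subst hs
    refine ⟨(Xᶜ, Y), ?_, ?_⟩
    · rw [Finset.mem_filter]
      refine ⟨Finset.mem_product.2 ⟨Finset.mem_univ _, Finset.mem_univ _⟩, ?_⟩
      unfold click
      unfold clickRel at h
      rw [compl_compl]
      simpa [Bool.and_comm] using h
    · exact (compl_sdiff_eq X Y).symm
  · rintro ⟨p, hp, rfl⟩
    rw [Finset.mem_filter] at hp
    refine ⟨p.1ᶜ \ p.2, ?_, ?_⟩
    · refine sdiff_mem_ZR (t := (ι p.1ᶜ, ι p.1ᶜᶜ)) (s := (ι p.2, ι p.2ᶜ)) ?_ ?_ ?_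
      · unfold sideTypes; exact Finset.mem_singleton_self _
      · unfold sideTypes; exact Finset.mem_singleton_self _
      · have h := hp.2
        unfold click at h
        unfold clickRel
        rw [compl_compl]
        simpa [Bool.and_comm] using h
    · rw [compl_sdiff_eq, compl_compl]

/-- Hence `#clickUnions ι = #ZR clickRel (sideTypes ι)`: the click count `(AC₀)` is the statement
`#{B1 points} + #{darts} ≤ 2 · #ZR clickRel (sideTypes ι)` about an allowed-difference family. [this work] -/
theorem card_clickUnions_eq (ι : Finset γ → Fin 15) : #(clickUnions ι) = #(ZR clickRel (sideTypes ι)) := by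
  rw [← image_compl_ZR_eq_clickUnions, Finset.card_image_of_injective _ compl_injective]

/-- **The click count in allowed-difference form**: `ClickCount B D` says that for every monotone cell map the `B`-points
and `D`-points number at most twice the allowed differences of `sideTypes ι` under `clickRel`.  With
`TypedMS.card_outer_add_card_inner_le` this is the form in which the Marica–Schönheim induction applies (memo §2–§3). [this work] -/
theorem clickCount_iff_ZR (B D : Finset (Fin 15 × Fin 15)) :
    ClickCount B D ↔
      ∀ (γ : Type) [Fintype γ] [DecidableEq γ] (ι : Finset γ → Fin 15),
        (∀ A B : Finset γ, A ⊆ B → ple (ι A) (ι B) = true) →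
          #(Finset.univ.filter fun T => (ι T, ι Tᶜ) ∈ B) + #(Finset.univ.filter fun T => (ι T, ι Tᶜ) ∈ D) ≤
            2 * #(ZR clickRel (sideTypes ι)) := by
  constructor
  · intro h γ _ _ ι hmono
    rw [← card_clickUnions_eq]
    exact h.le γ ι hmono
  · intro h
    refine ⟨fun γ _ _ ι hmono => ?_⟩
    rw [card_clickUnions_eq]
    exact h γ ι hmono

end click

end TypedMS

/-! ## The `{e}`-bonus (appended, gen 23): a bad pair at `e` puts `∅` into both slices -/

namespace TypedMS

open Finset

variable {γ : Type} [Fintype γ] [DecidableEq γ] {T : Type} [DecidableEq T]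
variable {R : T → T → Bool} {τ : Finset γ → Finset T} {e : γ}

omit [DecidableEq T] in
/-- A BAD PAIR at `e` — `X ⊆ Y` with `e ∉ Y`, a type of `insert e X` allowed against a type of `Y` — realises `{e}`
as an allowed difference, i.e. puts `∅` into `Z1`. [this work] -/
theorem empty_mem_Z1_of_bad {X Y : Finset γ} (hY : e ∉ Y) (hXY : X ⊆ Y) {t s : T}
    (ht : t ∈ τ (insert e X)) (hs : s ∈ τ Y) (h : R t s = true) : ∅ ∈ Z1 R τ e := by
  have hX : e ∉ X := fun hh => hY (hXY hh)
  have h1 := sdiff_mem_ZR (R := R) (τ := τ) ht hs h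
  rw [Finset.insert_sdiff_of_notMem _ hY, Finset.sdiff_eq_empty_iff_subset.2 hXY] at h1
  exact mem_Z1_of_insert h1 (Finset.notMem_empty _)

omit [DecidableEq T] in
/-- A containment `X ⊆ Y` with an allowed pair of types puts `∅` into `Z0`. [this work] -/
theorem empty_mem_Z0_of_subset {X Y : Finset γ} (hXY : X ⊆ Y) {t s : T}
    (ht : t ∈ τ X) (hs : s ∈ τ Y) (h : R t s = true) : ∅ ∈ Z0 R τ e := by
  have h1 := sdiff_mem_ZR (R := R) (τ := τ) ht hs h
  rw [Finset.sdiff_eq_empty_iff_subset.2 hXY] at h1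
  exact mem_Z0_iff.2 ⟨h1, Finset.notMem_empty _⟩

variable (R τ e)

/-- **Slicing with the `{e}`-bonus**: if `∅` lies in both slices (e.g. by `empty_mem_Z1_of_bad` and
`empty_mem_Z0_of_subset`) then the outer count alone loses at least one: `#ZR R (outer e τ) + 1 ≤ #ZR R τ`.
Together with `card_outer_add_card_inner_le` this is the recursion
`|Z| ≥ |Z(outer)| + max(|Z(inner)|, [∅ ∈ Z0 ∩ Z1])` of the memo (§2–§3). [this work] -/
theorem card_outer_succ_le (h0 : ∅ ∈ Z0 R τ e) (h1 : ∅ ∈ Z1 R τ e) :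
    #(ZR R (outer e τ)) + 1 ≤ #(ZR R τ) := by
  have hsub : ({∅} : Finset (Finset γ)) ⊆ Z0 R τ e ∩ Z1 R τ e := by
    intro S hS
    rw [Finset.mem_singleton] at hS
    subst hS
    exact Finset.mem_inter.2 ⟨h0, h1⟩
  calc #(ZR R (outer e τ)) + 1
      = #(ZR R (outer e τ)) + #({∅} : Finset (Finset γ)) := by rw [Finset.card_singleton]
    _ ≤ #(Z0 R τ e ∪ Z1 R τ e) + #(Z0 R τ e ∩ Z1 R τ e) :=
        Nat.add_le_add (Finset.card_le_card ZR_outer_subset) (Finset.card_le_card hsub)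
    _ = #(Z0 R τ e) + #(Z1 R τ e) := Finset.card_union_add_card_inter _ _
    _ = #(ZR R τ) := card_Z0_add_card_Z1 R τ e

end TypedMS

end Summit.CriticalPhenomena.PercolationContinuityZ3.Theorems
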